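import Summits.CriticalPhenomena.PercolationContinuityZ3.Theorems.TransplantHeisenberg
import HarnessLib

/-!
# `Cay(H₃(ℤ), {A^±, B^±})` is connected — the commutator walk

Builds on p205010 (kernel theorem, internal audit signed; external expert review pending).  Lane
`prim-bschramm`, class C2 (memo `run/shared/lean/prim/bschramm/P3-NILPOTENT.md` §6.2).  Proof-only sequel of
`TransplantHeisenberg.lean` (p207302): every `(a,b,c)` is reached from `0` by `Aᵃ`, then `Bᵇ` (landing at
`(a,b,ab)`), then `|c − ab|` commutator loops `A B A⁻¹ B⁻¹ = C` or their reverses.  Connectivity is a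
hypothesis of Burton–Keane uniqueness (KN Lemma 7) and of every Martineau–Severo quotient argument on
`H₃ × ℤ^k`. [folklore]
-/

noncomputable section

namespace Summit.CriticalPhenomena.PercolationContinuityZ3.Theorems.Heisenberg

open Literature.Probability.Percolation Literature.Probability.LatticeModels

/-- `A⁻¹ A = 1`. [folklore] -/
@[simp] theorem genAinv_mul_genA : heisMul genAinv genA = 0 := by
  ext i; fin_cases i <;> simp [heisMul, genA, genAinv]

/-- `B⁻¹ B = 1`. [folklore] -/
@[simp] theorem genBinv_mul_genB : heisMul genBinv genB = 0 := by
  ext i; fin_cases i <;> simp [heisMul, genB, genBinv]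

/-- `x·s = x` only for `s = 1`. [folklore] -/
theorem heisMul_eq_self_iff (x s : HV) : heisMul x s = x ↔ s = 0 := by
  constructor
  · intro h
    exact heisMul_right_injective x (h.trans (heisMul_zero x).symm)
  · rintro rfl; exact heisMul_zero x

/-- `x ∼ x·s` for each of the four generators. [folklore] -/
theorem adj_mul_gen (x : HV) {s : HV} (hs : s = genA ∨ s = genB ∨ s = genAinv ∨ s = genBinv) :
    heisenbergGraph.Adj x (heisMul x s) := by
  rw [heisenbergGraph_adj]
  have hs0 : s ≠ 0 := by
    rcases hs with rfl | rfl | rfl | rfl <;> decide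
  refine ⟨fun h => hs0 ((heisMul_eq_self_iff x s).1 h.symm), ?_⟩
  rcases hs with rfl | rfl | rfl | rfl
  · exact Or.inl (Or.inl rfl)
  · exact Or.inl (Or.inr rfl)
  · exact Or.inr (Or.inl (by rw [heisMul_assoc, genAinv_mul_genA, heisMul_zero]))
  · exact Or.inr (Or.inr (by rw [heisMul_assoc, genBinv_mul_genB, heisMul_zero]))

/-- Reachability from `0` is stable under right multiplication by a generator. [folklore] -/
theorem reachable_mul_gen {x : HV} (hx : heisenbergGraph.Reachable 0 x) {s : HV}
    (hs : s = genA ∨ s = genB ∨ s = genAinv ∨ s = genBinv) :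
    heisenbergGraph.Reachable 0 (heisMul x s) :=
  hx.trans (adj_mul_gen x hs).reachable

/-- `0 ↝ (a,0,0)`. [folklore] -/
theorem reachable_axisA (a : ℤ) : heisenbergGraph.Reachable 0 ![a, 0, 0] := by
  induction a using Int.induction_on with
  | zero =>
    have : (![0, 0, 0] : HV) = 0 := by ext i; fin_cases i <;> rfl
    rw [this]
  | succ n ih =>
    have h := reachable_mul_gen ih (s := genA) (Or.inl rfl)
    have he : heisMul ![(n : ℤ), 0, 0] genA = ![(n : ℤ) + 1, 0, 0] := by
      ext i; fin_cases i <;> simp [heisMul, genA]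
    rwa [he] at h
  | pred n ih =>
    have h := reachable_mul_gen ih (s := genAinv) (Or.inr (Or.inr (Or.inl rfl)))
    have he : heisMul ![-(n : ℤ), 0, 0] genAinv = ![-(n : ℤ) - 1, 0, 0] := by
      ext i; fin_cases i <;> simp [heisMul, genAinv, sub_eq_add_neg]
    rwa [he] at h

/-- `0 ↝ (a,b,ab)`. [folklore] -/
theorem reachable_AB (a b : ℤ) : heisenbergGraph.Reachable 0 ![a, b, a * b] := by
  induction b using Int.induction_on with
  | zero => simpa using reachable_axisA a
  | succ n ih =>
    have h := reachable_mul_gen ih (s := genB) (Or.inr (Or.inl rfl))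
    have he : heisMul ![a, (n : ℤ), a * n] genB = ![a, (n : ℤ) + 1, a * (n + 1)] := by
      ext i; fin_cases i <;> simp [heisMul, genB]
      ring
    rwa [he] at h
  | pred n ih =>
    have h := reachable_mul_gen ih (s := genBinv) (Or.inr (Or.inr (Or.inr rfl)))
    have he : heisMul ![a, -(n : ℤ), a * -n] genBinv = ![a, -(n : ℤ) - 1, a * (-n - 1)] := by
      ext i; fin_cases i <;> simp [heisMul, genBinv] <;> ring
    rwa [he] at h

/-- The commutator walk raises `c` by one. [folklore] -/
theorem commutator_up (x : HV) :
    heisMul (heisMul (heisMul (heisMul x genA) genB) genAinv) genBinv = ![x 0, x 1, x 2 + 1] := by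
  ext i; fin_cases i <;> simp [heisMul, genA, genB, genAinv, genBinv]
  ring

/-- The reverse commutator walk lowers `c` by one. [folklore] -/
theorem commutator_down (x : HV) :
    heisMul (heisMul (heisMul (heisMul x genB) genA) genBinv) genAinv = ![x 0, x 1, x 2 - 1] := by
  ext i; fin_cases i <;> simp [heisMul, genA, genB, genAinv, genBinv]
  ring

/-- `0 ↝ (a,b,ab+m)` for every `m`. [folklore] -/
theorem reachable_ABC (a b m : ℤ) : heisenbergGraph.Reachable 0 ![a, b, a * b + m] := by
  induction m using Int.induction_on with
  | zero => simpa using reachable_AB a b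
  | succ n ih =>
    have h1 := reachable_mul_gen ih (s := genA) (Or.inl rfl)
    have h2 := reachable_mul_gen h1 (s := genB) (Or.inr (Or.inl rfl))
    have h3 := reachable_mul_gen h2 (s := genAinv) (Or.inr (Or.inr (Or.inl rfl)))
    have h4 := reachable_mul_gen h3 (s := genBinv) (Or.inr (Or.inr (Or.inr rfl)))
    rw [commutator_up] at h4
    have he : (![(![a, b, a * b + n] : HV) 0, (![a, b, a * b + n] : HV) 1,
        (![a, b, a * b + n] : HV) 2 + 1] : HV) = ![a, b, a * b + (n + 1)] := by
      ext i; fin_cases i <;> simp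
      ring
    rwa [he] at h4
  | pred n ih =>
    have h1 := reachable_mul_gen ih (s := genB) (Or.inr (Or.inl rfl))
    have h2 := reachable_mul_gen h1 (s := genA) (Or.inl rfl)
    have h3 := reachable_mul_gen h2 (s := genBinv) (Or.inr (Or.inr (Or.inr rfl)))
    have h4 := reachable_mul_gen h3 (s := genAinv) (Or.inr (Or.inr (Or.inl rfl)))
    rw [commutator_down] at h4
    have he : (![(![a, b, a * b + -n] : HV) 0, (![a, b, a * b + -n] : HV) 1,
        (![a, b, a * b + -n] : HV) 2 - 1] : HV) = ![a, b, a * b + (-n - 1)] := by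
      ext i; fin_cases i <;> simp
      ring
    rwa [he] at h4

/-- `0 ↝ (a,b,c)` for every vertex. [folklore] -/
theorem reachable_all (a b c : ℤ) : heisenbergGraph.Reachable 0 ![a, b, c] := by
  have := reachable_ABC a b (c - a * b)
  rwa [add_sub_cancel] at this

/-- **`Cay(H₃(ℤ), {A^±, B^±})` is connected.** [folklore] -/
theorem heisenbergGraph_connected : heisenbergGraph.Connected := by
  haveI : Nonempty HV := ⟨0⟩
  refine SimpleGraph.Connected.mk fun x y => ?_
  have hx : heisenbergGraph.Reachable 0 x := by
    have := reachable_all (x 0) (x 1) (x 2)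
    have he : (![x 0, x 1, x 2] : HV) = x := by ext i; fin_cases i <;> rfl
    rwa [he] at this
  have hy : heisenbergGraph.Reachable 0 y := by
    have := reachable_all (y 0) (y 1) (y 2)
    have he : (![y 0, y 1, y 2] : HV) = y := by ext i; fin_cases i <;> rfl
    rwa [he] at this
  exact hx.symm.trans hy

end Summit.CriticalPhenomena.PercolationContinuityZ3.Theorems.Heisenberg
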